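import Literature.AlgebraicGeometry.HodgeTheory.WeilSurfaceCMSquare
import Literature.AlgebraicGeometry.Motives.AimedSplitProductProofs
import HarnessLib

/-!
# The descent pair on the CM square `E₀ × E₀` (surface half of the aiming lemma, CM form)

Layer `Literature/AlgebraicGeometry/Motives`, theorems-only companion of `Motives/AimedSplitProduct`
(the named fact `exists_cmWeilSurface_aimedSplitProduct_of_ne_one_of_ne_three`, the aiming lemma of
the Schoen/Koike/Markman product trick) and of `HodgeTheory/WeilSurfaceCMSquare` (the CM square
`B = E₀ × E₀`, `Φ = ψ₀ × (-ψ₀)`, is a Weil-type surface: `exists_weilType_cmSquare`). The fact opens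
with a SURFACE conjunct — a surface `(B, ψ)`, `ψ ≫ ψ = -d`, carrying a DESCENT PAIR: classes
`b₊ ∈ Eig((𝟙+ψ)^*, (1+i√d)²)`, `b₋ ∈ Eig((𝟙+ψ)^*, (1-i√d)²)` of `H²(B(ℂ); ℂ)` with `b₊ + b₋` rational
of Hodge type `(1,1)`, and an ALGEBRAIC class `η ∈ N¹H²(B(ℂ); ℂ)` with `b₊ ⌣ η ≠ 0`, `b₋ ⌣ η ≠ 0` —
and the SAME `B` must then serve the aiming half for every Weil-type `(A, φ)`; in print
(C. Schoen, Compositio Math. 114 (1998) §10; B. van Geemen, LNM 1594, 5.3; E. Markman,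
arXiv:2509.23403 §11.5 Step 2) that surface is the CM square `E₀ × E₀`, `K` acting through
`(ι, ῑ)`, and Schoen's descent uses "`W_{A'}` is generated by cohomology classes of divisors" and
"`ω_{5,σ₁} ∧ ω_{6,σ₁} ∧ ω_{5,σ₂} ∧ ω_{6,σ₂}` is a basis for `H⁴(A'; ℂ)`". The tree's two proved
surface halves (`Motives.exists_weilSurface_descentPair`, file `AimedSplitProductProofs`, and the
summit-side `…StubAimedSplitProductFact.exists_weilSurface_descentPair`) use the COMPANION surface
`E × E`, `ψ = ((0,-d),(1,0))` of a curve WITHOUT complex multiplication, which cannot serve the aiming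
half (its `K`-compatible Néron–Severi classes realise a single discriminant class; module docstring of
`AimedSplitProductProofs`, CAVEAT). This file proves the descent pair ON THE CM SQUARE, given the CM
curve `(E₀, ψ₀)`, `ψ₀ ≫ ψ₀ = -d`, as data (`exists_descentPair_cmSquare`):

* `b₊ = pr₁^* w₊ ∪ pr₂^* w₋`, `b₋ = pr₁^* w₋ ∪ pr₂^* w₊` for the eigenvectors `w± = ψ₀^*v ± i√d·v` of
  `ψ₀^*` on `H¹(E₀(ℂ); ℂ) = ℂv ⊕ ℂψ₀^*v` (`v ≠ 0` rational) — the Weil classes `u±` of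
  `exists_weilType_cmSquare` (same construction, re-run here because that theorem only asserts their
  existence): `b± ∈ E±(B, Φ) = weilClassesPlus/Minus B Φ 1 d`, hence in the `(1 ± i√d)²`-eigenspaces of
  the single test endomorphism `(𝟙 + Φ)^*`; `b₊ + b₋ = 2·pr₁^*ψ₀^*v ∪ pr₂^*ψ₀^*v + 2d·pr₁^*v ∪ pr₂^*v`
  is rational, of Hodge type `(1,1)` (purity of `w₊`, Künneth for Hodge types fed with de Rham's
  theorem — verbatim the argument of `WeilSurfaceCMSquare`);
* `η = (pr₁ + pr₂)^* ω₀`, `ω₀ = v ∪ ψ₀^*v ≠ 0` the top class of `E₀` — in print the class of the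
  anti-diagonal divisor `{x + y = 0}`-type pull-back of a point: `ω₀ ∈ N¹H²(E₀)` (every top-degree
  class of a smooth projective curve is algebraic, `mem_algebraicClasses_of_degree_top`) and the sum
  homomorphism `pr₁ + pr₂ : E₀ × E₀ → E₀` is FLAT — it is the shear automorphism `(x, y) ↦ (x, x + y)`
  followed by `pr₂` (`flat_toSchemeHom_fst_add_snd`) — so `η` is algebraic
  (`map_mem_algebraicClasses_of_flat`);
* **`b₊ ⌣ η = -2i√d · pr₁^*ω₀ ∪ pr₂^*ω₀ ≠ 0`, `b₋ ⌣ η = +2i√d · pr₁^*ω₀ ∪ pr₂^*ω₀ ≠ 0`**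
  (`cupProduct_weilComponent_sumClass`): `(pr₁ + pr₂)^*` is additive on `H¹`
  (`complexBetti_map_add_deg_one`), so `η = pr₁^*ω₀ + pr₁^*v ∪ pr₂^*ψ₀^*v + pr₂^*v ∪ pr₁^*ψ₀^*v + pr₂^*ω₀`;
  the four-fold products `(pr₁^*x ∪ pr₂^*y) ∪ (pr₁^*z ∪ pr₁^*u)`, `… ∪ (pr₂^*z ∪ pr₂^*u)` vanish
  (`H³(E₀(ℂ)) = 0`), and `(pr₁^*x ∪ pr₂^*y) ∪ (pr₁^*z ∪ pr₂^*u) = -pr₁^*(x ∪ z) ∪ pr₂^*(y ∪ u)`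
  (associativity and graded commutativity of `∪`); `pr₁^*ω₀ ∪ pr₂^*ω₀ ≠ 0` by the uniqueness half of
  the Künneth theorem (`cupProduct_map_fst_map_snd_ne_zero`). This is Schoen's basis statement for
  `H⁴(A'; ℂ)` in cohomological form.

`exists_cmSquare_surfaceConjunct` packages the result in the exact typing of the surface conjunct of
`exists_cmWeilSurface_aimedSplitProduct_of_ne_one_of_ne_three` (with `ψ ≫ ψ = -((d : ℤ) • 𝟙 B)`).
Everything is proved; no definition and no named fact is introduced (D-0026). What is NOT here: the
CM curve `(E₀, ψ₀)` itself (summit side: `…CmCurveSqrt.exists_cmCurveSqrt`), and the aiming half.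

## References

* [Schoen1998HodgeWeilAddendum] C. Schoen, Addendum to: Hodge classes on self-products of a variety
  with an automorphism, Compositio Math. 114 (1998), §10 (proof of the Proposition, p. 333).
* [vanGeemen1994HodgeAV] B. van Geemen, An introduction to the Hodge conjecture for abelian
  varieties, LNM 1594 (1994), 5.3 and proof of Lemma 5.2.
* [Markman2025SurveySecant] E. Markman, arXiv:2509.23403, §11.5 Step 2.
* [HatcherAT2002] A. Hatcher, Algebraic Topology (2002), §3.2 Prop. 3.10, Thm. 3.11, Thm. 3.16.
-/

noncomputable section

open CategoryTheory AlgebraicGeometry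
open Literature.AlgebraicGeometry.HodgeTheory
open Literature.AlgebraicTopology.SingularHomology

namespace Literature.AlgebraicGeometry.Motives

/-! ### Four-fold cup products of pulled-back degree-one classes on `E × E` -/

section FourFold

variable {E : AbelianVariety ℂ}

/-- **`(pr₁^*x ∪ pr₂^*y) ∪ (pr₁^*z ∪ pr₂^*u) = -pr₁^*(x ∪ z) ∪ pr₂^*(y ∪ u)`** on `E × E` for
degree-one classes (associativity and graded commutativity of `∪`, naturality of pull-back:
the middle swap `pr₂^*y ↔ pr₁^*z` costs the sign). [cite: HatcherAT2002, §3.2 Prop. 3.10 and Thm. 3.11] -/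
theorem cup_fstSnd_cup_fstSnd (x y z u : complexBetti E.X 1) :
    cupProduct (show 2 + 2 = 4 from rfl)
      (cupProduct (show 1 + 1 = 2 from rfl) (complexBetti.map (AbelianVariety.fst E E).hom.hom.hom 1 x)
        (complexBetti.map (AbelianVariety.snd E E).hom.hom.hom 1 y))
      (cupProduct (show 1 + 1 = 2 from rfl) (complexBetti.map (AbelianVariety.fst E E).hom.hom.hom 1 z)
        (complexBetti.map (AbelianVariety.snd E E).hom.hom.hom 1 u)) =
    -cupProduct (show 2 + 2 = 4 from rfl)
      (complexBetti.map (AbelianVariety.fst E E).hom.hom.hom 2 (cupProduct (show 1 + 1 = 2 from rfl) x z))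
      (complexBetti.map (AbelianVariety.snd E E).hom.hom.hom 2 (cupProduct (show 1 + 1 = 2 from rfl) y u)) := by
  set F := complexBetti.map (AbelianVariety.fst E E).hom.hom.hom with hF
  set S := complexBetti.map (AbelianVariety.snd E E).hom.hom.hom with hS
  -- `Sy ∪ (Fz ∪ Su) = (Sy ∪ Fz) ∪ Su = -((Fz ∪ Sy) ∪ Su) = -(Fz ∪ S(y ∪ u))`
  have h1 : cupProduct (show 1 + 2 = 3 from rfl) (S 1 y)
      (cupProduct (show 1 + 1 = 2 from rfl) (F 1 z) (S 1 u)) =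
      -cupProduct (show 1 + 2 = 3 from rfl) (F 1 z) (S 2 (cupProduct (show 1 + 1 = 2 from rfl) y u)) := by
    rw [← cupProduct_assoc (show 1 + 1 = 2 from rfl) (show 1 + 1 = 2 from rfl) (show 2 + 1 = 3 from rfl)
      (show 1 + 2 = 3 from rfl),
      cupProduct_gradedComm_holds ℂ _ (show 1 + 1 = 2 from rfl) (show 1 + 1 = 2 from rfl) (S 1 y) (F 1 z),
      map_smul, LinearMap.smul_apply,
      cupProduct_assoc (show 1 + 1 = 2 from rfl) (show 1 + 1 = 2 from rfl) (show 2 + 1 = 3 from rfl)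
      (show 1 + 2 = 3 from rfl), hS, ← cupProduct_map]
    norm_num
  rw [cupProduct_assoc (show 1 + 1 = 2 from rfl) (show 1 + 2 = 3 from rfl) (show 2 + 2 = 4 from rfl)
    (show 1 + 3 = 4 from rfl), h1, map_neg,
    ← cupProduct_assoc (show 1 + 1 = 2 from rfl) (show 1 + 2 = 3 from rfl) (show 2 + 2 = 4 from rfl)
    (show 1 + 3 = 4 from rfl), hF, ← cupProduct_map]

/-- **`(pr₁^*x ∪ pr₂^*y) ∪ (pr₂^*z ∪ pr₁^*u) = pr₁^*(x ∪ u) ∪ pr₂^*(y ∪ z)`** on `E × E` for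
degree-one classes (swap the last two factors, then `cup_fstSnd_cup_fstSnd`).
[cite: HatcherAT2002, §3.2 Prop. 3.10 and Thm. 3.11] -/
theorem cup_fstSnd_cup_sndFst (x y z u : complexBetti E.X 1) :
    cupProduct (show 2 + 2 = 4 from rfl)
      (cupProduct (show 1 + 1 = 2 from rfl) (complexBetti.map (AbelianVariety.fst E E).hom.hom.hom 1 x)
        (complexBetti.map (AbelianVariety.snd E E).hom.hom.hom 1 y))
      (cupProduct (show 1 + 1 = 2 from rfl) (complexBetti.map (AbelianVariety.snd E E).hom.hom.hom 1 z)
        (complexBetti.map (AbelianVariety.fst E E).hom.hom.hom 1 u)) =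
    cupProduct (show 2 + 2 = 4 from rfl)
      (complexBetti.map (AbelianVariety.fst E E).hom.hom.hom 2 (cupProduct (show 1 + 1 = 2 from rfl) x u))
      (complexBetti.map (AbelianVariety.snd E E).hom.hom.hom 2 (cupProduct (show 1 + 1 = 2 from rfl) y z)) := by
  rw [cupProduct_gradedComm_holds ℂ _ (show 1 + 1 = 2 from rfl) (show 1 + 1 = 2 from rfl)
      (complexBetti.map (AbelianVariety.snd E E).hom.hom.hom 1 z)
      (complexBetti.map (AbelianVariety.fst E E).hom.hom.hom 1 u),
    map_smul, cup_fstSnd_cup_fstSnd, smul_neg]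
  norm_num

/-- **`(pr₁^*x ∪ pr₂^*y) ∪ (pr₁^*z ∪ pr₁^*u) = 0`** on `E × E` for a CURVE `E` and degree-one
classes: three factors come from the first projection, and `H³(E(ℂ); ℂ) = 0`.
[cite: HatcherAT2002, §3.2 Prop. 3.10 and Thm. 3.11] -/
theorem cup_fstSnd_cup_fstFst_eq_zero (hdim : E.dim = 1) (x y z u : complexBetti E.X 1) :
    cupProduct (show 2 + 2 = 4 from rfl)
      (cupProduct (show 1 + 1 = 2 from rfl) (complexBetti.map (AbelianVariety.fst E E).hom.hom.hom 1 x)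
        (complexBetti.map (AbelianVariety.snd E E).hom.hom.hom 1 y))
      (cupProduct (show 1 + 1 = 2 from rfl) (complexBetti.map (AbelianVariety.fst E E).hom.hom.hom 1 z)
        (complexBetti.map (AbelianVariety.fst E E).hom.hom.hom 1 u)) = 0 := by
  have hE : IsSmoothProjective 1 E.X := isSmoothProjective_of_dim_eq' hdim
  haveI h3 : Subsingleton (complexBetti E.X 3) := subsingleton_complexBetti hE (by norm_num)
  set F := complexBetti.map (AbelianVariety.fst E E).hom.hom.hom with hF
  set S := complexBetti.map (AbelianVariety.snd E E).hom.hom.hom with hS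
  -- `Fz ∪ Fu = F(z ∪ u)` and `Sy ∪ F(zu) = F(zu) ∪ Sy`
  have h1 : cupProduct (show 1 + 2 = 3 from rfl) (S 1 y)
      (cupProduct (show 1 + 1 = 2 from rfl) (F 1 z) (F 1 u)) =
      cupProduct (show 2 + 1 = 3 from rfl) (F 2 (cupProduct (show 1 + 1 = 2 from rfl) z u)) (S 1 y) := by
    rw [hF, ← cupProduct_map,
      cupProduct_gradedComm_holds ℂ _ (show 1 + 2 = 3 from rfl) (show 2 + 1 = 3 from rfl)]
    norm_num
  -- `Fx ∪ F(zu) = F(x ∪ zu) = 0`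
  have h2 : cupProduct (show 1 + 2 = 3 from rfl) (F 1 x) (F 2 (cupProduct (show 1 + 1 = 2 from rfl) z u)) = 0 := by
    rw [hF, ← cupProduct_map, Subsingleton.elim (cupProduct (show 1 + 2 = 3 from rfl) x _) 0, map_zero]
  rw [cupProduct_assoc (show 1 + 1 = 2 from rfl) (show 1 + 2 = 3 from rfl) (show 2 + 2 = 4 from rfl)
    (show 1 + 3 = 4 from rfl), h1,
    ← cupProduct_assoc (show 1 + 2 = 3 from rfl) (show 2 + 1 = 3 from rfl) (show 3 + 1 = 4 from rfl)
    (show 1 + 3 = 4 from rfl), h2, LinearMap.map_zero₂]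

/-- **`(pr₁^*x ∪ pr₂^*y) ∪ (pr₂^*z ∪ pr₂^*u) = 0`** on `E × E` for a CURVE `E` and degree-one
classes: three factors come from the second projection, and `H³(E(ℂ); ℂ) = 0`.
[cite: HatcherAT2002, §3.2 Prop. 3.10 and Thm. 3.11] -/
theorem cup_fstSnd_cup_sndSnd_eq_zero (hdim : E.dim = 1) (x y z u : complexBetti E.X 1) :
    cupProduct (show 2 + 2 = 4 from rfl)
      (cupProduct (show 1 + 1 = 2 from rfl) (complexBetti.map (AbelianVariety.fst E E).hom.hom.hom 1 x)
        (complexBetti.map (AbelianVariety.snd E E).hom.hom.hom 1 y))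
      (cupProduct (show 1 + 1 = 2 from rfl) (complexBetti.map (AbelianVariety.snd E E).hom.hom.hom 1 z)
        (complexBetti.map (AbelianVariety.snd E E).hom.hom.hom 1 u)) = 0 := by
  have hE : IsSmoothProjective 1 E.X := isSmoothProjective_of_dim_eq' hdim
  haveI h3 : Subsingleton (complexBetti E.X 3) := subsingleton_complexBetti hE (by norm_num)
  set F := complexBetti.map (AbelianVariety.fst E E).hom.hom.hom with hF
  set S := complexBetti.map (AbelianVariety.snd E E).hom.hom.hom with hS
  -- `Sy ∪ (Sz ∪ Su) = S(y ∪ (z ∪ u)) = 0`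
  have h1 : cupProduct (show 1 + 2 = 3 from rfl) (S 1 y)
      (cupProduct (show 1 + 1 = 2 from rfl) (S 1 z) (S 1 u)) = 0 := by
    rw [hS, ← cupProduct_map, ← cupProduct_map,
      Subsingleton.elim (cupProduct (show 1 + 2 = 3 from rfl) y _) 0, map_zero]
  rw [cupProduct_assoc (show 1 + 1 = 2 from rfl) (show 1 + 2 = 3 from rfl) (show 2 + 2 = 4 from rfl)
    (show 1 + 3 = 4 from rfl), h1, map_zero]

/-- **The Weil components of the CM square against the sum class** (Schoen's basis computation for
`H⁴(A'; ℂ)`, Compositio 114 (1998) §10, in cohomological form). On `E × E`, `E` a curve, for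
`v, w ∈ H¹(E(ℂ); ℂ)`, `t ∈ ℂ` and the class `Σ = (pr₁^*v + pr₂^*v) ∪ (pr₁^*w + pr₂^*w)` (the pull-back
of `v ∪ w` along the sum homomorphism `pr₁ + pr₂`):
`(pr₁^*(w + t v) ∪ pr₂^*(w - t v)) ∪ Σ = -2t · pr₁^*(v ∪ w) ∪ pr₂^*(v ∪ w)` — the two pure Künneth
terms of `Σ` die (`cup_fstSnd_cup_fstFst_eq_zero`, `cup_fstSnd_cup_sndSnd_eq_zero`), the two mixed
ones contribute `-t` each (`cup_fstSnd_cup_fstSnd`, `cup_fstSnd_cup_sndFst`, with `v ∪ v = w ∪ w = 0`,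
`w ∪ v = -v ∪ w`). [cite: Schoen1998HodgeWeilAddendum, §10 (proof of the Proposition, p. 333)] -/
theorem cupProduct_weilComponent_sumClass (hdim : E.dim = 1) (t : ℂ) (v w : complexBetti E.X 1) :
    cupProduct (show 2 + 2 = 4 from rfl)
      (cupProduct (show 1 + 1 = 2 from rfl)
        (complexBetti.map (AbelianVariety.fst E E).hom.hom.hom 1 (w + t • v))
        (complexBetti.map (AbelianVariety.snd E E).hom.hom.hom 1 (w - t • v)))
      (cupProduct (show 1 + 1 = 2 from rfl)
        (complexBetti.map (AbelianVariety.fst E E).hom.hom.hom 1 v +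
          complexBetti.map (AbelianVariety.snd E E).hom.hom.hom 1 v)
        (complexBetti.map (AbelianVariety.fst E E).hom.hom.hom 1 w +
          complexBetti.map (AbelianVariety.snd E E).hom.hom.hom 1 w)) =
    (-(2 * t)) • cupProduct (show 2 + 2 = 4 from rfl)
      (complexBetti.map (AbelianVariety.fst E E).hom.hom.hom 2 (cupProduct (show 1 + 1 = 2 from rfl) v w))
      (complexBetti.map (AbelianVariety.snd E E).hom.hom.hom 2 (cupProduct (show 1 + 1 = 2 from rfl) v w)) := by
  -- degree-one identities on `E`: `v ∪ v = w ∪ w = 0`, `w ∪ v = -v ∪ w`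
  have hvv : cupProduct (show 1 + 1 = 2 from rfl) v v = 0 := cup_self_deg_one v
  have hww : cupProduct (show 1 + 1 = 2 from rfl) w w = 0 := cup_self_deg_one w
  have hwv : cupProduct (show 1 + 1 = 2 from rfl) w v = -cupProduct (show 1 + 1 = 2 from rfl) v w := by
    have h := cupProduct_gradedComm_holds ℂ (ComplexPoints E.X) (show 1 + 1 = 2 from rfl) rfl w v
    simpa using h
  have hxv : cupProduct (show 1 + 1 = 2 from rfl) (w + t • v) v =
      -cupProduct (show 1 + 1 = 2 from rfl) v w := by
    rw [map_add, map_smul, LinearMap.add_apply, LinearMap.smul_apply, hvv, hwv, smul_zero, add_zero]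
  have hyw : cupProduct (show 1 + 1 = 2 from rfl) (w - t • v) w =
      (-t) • cupProduct (show 1 + 1 = 2 from rfl) v w := by
    rw [map_sub, map_smul, LinearMap.sub_apply, LinearMap.smul_apply, hww, zero_sub, neg_smul]
  have hxw : cupProduct (show 1 + 1 = 2 from rfl) (w + t • v) w =
      t • cupProduct (show 1 + 1 = 2 from rfl) v w := by
    rw [map_add, map_smul, LinearMap.add_apply, LinearMap.smul_apply, hww, zero_add]
  have hyv : cupProduct (show 1 + 1 = 2 from rfl) (w - t • v) v =
      -cupProduct (show 1 + 1 = 2 from rfl) v w := by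
    rw [map_sub, map_smul, LinearMap.sub_apply, LinearMap.smul_apply, hvv, hwv, smul_zero, sub_zero]
  -- protect the Weil component, expand the sum class into its four Künneth terms, distribute
  set bp := cupProduct (show 1 + 1 = 2 from rfl)
    (complexBetti.map (AbelianVariety.fst E E).hom.hom.hom 1 (w + t • v))
    (complexBetti.map (AbelianVariety.snd E E).hom.hom.hom 1 (w - t • v)) with hbp
  simp only [map_add, LinearMap.add_apply]
  -- the four four-fold products
  rw [hbp, cup_fstSnd_cup_fstFst_eq_zero hdim, cup_fstSnd_cup_fstSnd, cup_fstSnd_cup_sndFst,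
    cup_fstSnd_cup_sndSnd_eq_zero hdim, hxv, hyw, hxw, hyv]
  simp only [map_neg, map_smul, LinearMap.neg_apply, LinearMap.smul_apply, smul_neg, neg_neg,
    zero_add, add_zero]
  module

end FourFold

/-! ### The sum homomorphism `pr₁ + pr₂ : E × E → E` is flat -/

section SumHom

variable (E : AbelianVariety ℂ)

/-- The shear `(x, y) ↦ (x, x + y)` followed by the unshear `(x, y) ↦ (x, y - x)` is the identity.
[folklore] -/
theorem shear_comp_unshear :
    AbelianVariety.prodLift (AbelianVariety.fst E E) (AbelianVariety.fst E E + AbelianVariety.snd E E) ≫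
        AbelianVariety.prodLift (AbelianVariety.fst E E) (AbelianVariety.snd E E - AbelianVariety.fst E E) =
      𝟙 (E.prod E) := by
  apply AbelianVariety.prod_hom_ext
  · rw [Category.assoc, AbelianVariety.prodLift_fst, AbelianVariety.prodLift_fst, Category.id_comp]
  · rw [Category.assoc, AbelianVariety.prodLift_snd, Preadditive.comp_sub, AbelianVariety.prodLift_snd,
      AbelianVariety.prodLift_fst, Category.id_comp, add_sub_cancel_left]

/-- The unshear `(x, y) ↦ (x, y - x)` followed by the shear `(x, y) ↦ (x, x + y)` is the identity.
[folklore] -/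
theorem unshear_comp_shear :
    AbelianVariety.prodLift (AbelianVariety.fst E E) (AbelianVariety.snd E E - AbelianVariety.fst E E) ≫
        AbelianVariety.prodLift (AbelianVariety.fst E E) (AbelianVariety.fst E E + AbelianVariety.snd E E) =
      𝟙 (E.prod E) := by
  apply AbelianVariety.prod_hom_ext
  · rw [Category.assoc, AbelianVariety.prodLift_fst, AbelianVariety.prodLift_fst, Category.id_comp]
  · rw [Category.assoc, AbelianVariety.prodLift_snd, Preadditive.comp_add, AbelianVariety.prodLift_snd,
      AbelianVariety.prodLift_fst, Category.id_comp, add_sub_cancel]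

/-- **The sum homomorphism `pr₁ + pr₂ : E × E → E` is flat**: it is the shear AUTOMORPHISM
`(x, y) ↦ (x, x + y)` of `E × E` followed by the (flat) second projection. [folklore] -/
theorem flat_toSchemeHom_fst_add_snd :
    Flat (AbelianVariety.fst E E + AbelianVariety.snd E E).hom.hom.hom.left := by
  have h1 := congrArg (fun f : E.prod E ⟶ E.prod E ↦ f.hom.hom.hom.left) (shear_comp_unshear E)
  have h2 := congrArg (fun f : E.prod E ⟶ E.prod E ↦ f.hom.hom.hom.left) (unshear_comp_shear E)
  haveI : IsIso (AbelianVariety.prodLift (AbelianVariety.fst E E)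
      (AbelianVariety.fst E E + AbelianVariety.snd E E)).hom.hom.hom.left :=
    ⟨⟨(AbelianVariety.prodLift (AbelianVariety.fst E E)
      (AbelianVariety.snd E E - AbelianVariety.fst E E)).hom.hom.hom.left, h1, h2⟩⟩
  have hτ : Flat (AbelianVariety.prodLift (AbelianVariety.fst E E)
      (AbelianVariety.fst E E + AbelianVariety.snd E E)).hom.hom.hom.left :=
    MorphismProperty.of_isIso @Flat _
  have hsnd : Flat (AbelianVariety.snd E E).hom.hom.hom.left :=
    inferInstanceAs (Flat (Limits.pullback.snd E.X.hom E.X.hom))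
  have hcomp := MorphismProperty.comp_mem @Flat _ _ hτ hsnd
  have e : AbelianVariety.fst E E + AbelianVariety.snd E E =
      AbelianVariety.prodLift (AbelianVariety.fst E E) (AbelianVariety.fst E E + AbelianVariety.snd E E) ≫
        AbelianVariety.snd E E :=
    (AbelianVariety.prodLift_snd _ _).symm
  rw [e]
  exact hcomp

/-- **`(pr₁ + pr₂)^*` preserves algebraic classes**: the pull-back of `N^p H^{2p}(E(ℂ))` along the
flat sum homomorphism lies in `N^p H^{2p}((E × E)(ℂ))` (`map_mem_algebraicClasses_of_flat`).
[cite: VoisinHodgeII2003, Prop. 9.21 (i)] -/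
theorem map_fst_add_snd_mem_algebraicClasses {p : ℕ} {a : complexBetti E.X (2 * p)}
    (ha : a ∈ algebraicClasses E.X p) :
    complexBetti.map (AbelianVariety.fst E E + AbelianVariety.snd E E).hom.hom.hom (2 * p) a ∈
      algebraicClasses (E.prod E).X p := by
  haveI := flat_toSchemeHom_fst_add_snd E
  exact map_mem_algebraicClasses_of_flat (AbelianVariety.fst E E + AbelianVariety.snd E E).hom.hom.hom ha

end SumHom

-- SCRATCH-CUT

/-! ### The descent pair on the CM square -/

section CMSquare

variable {E₀ : AbelianVariety ℂ} {d : ℕ} {ψ₀ : E₀ ⟶ E₀}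

/-- **The descent pair on the CM square** (Schoen 1998 §10; van Geemen 1994, 5.3). Let `E₀` be a
complex abelian variety of dimension `1` with `ψ₀ ≫ ψ₀ = -(d • 𝟙)`, `d ≥ 1`, `B = E₀ × E₀`,
`Φ = ψ₀ × (-ψ₀)`. Then there are `b₊ ∈ E₊(B, Φ) = weilClassesPlus B Φ 1 d`,
`b₋ ∈ E₋(B, Φ) = weilClassesMinus B Φ 1 d` with `b₊ + b₋` RATIONAL of Hodge type `(1,1)`, and an
ALGEBRAIC class `η ∈ N¹H²(B(ℂ); ℂ)` with `b₊ ⌣ η ≠ 0`, `b₋ ⌣ η ≠ 0` (hence `b₊ ≠ 0`, `b₋ ≠ 0`):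
`b₊ = pr₁^*w₊ ∪ pr₂^*w₋`, `b₋ = pr₁^*w₋ ∪ pr₂^*w₊` (`w± = ψ₀^*v ± i√d·v`, the classes of
`exists_weilType_cmSquare`) and `η = (pr₁ + pr₂)^*(v ∪ ψ₀^*v)`; `b± ⌣ η = ∓2i√d · pr₁^*ω₀ ∪ pr₂^*ω₀`
(`cupProduct_weilComponent_sumClass`), non-zero by Künneth. Proof: module docstring.
[cite: Schoen1998HodgeWeilAddendum, §10 (proof of the Proposition, p. 333)]
[cite: vanGeemen1994HodgeAV, 5.3 and proof of Lemma 5.2] -/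
theorem exists_descentPair_cmSquare (hE : E₀.dim = 1) (hd : 0 < d) (hψ : ψ₀ ≫ ψ₀ = -(d • 𝟙 E₀)) :
    ∃ bp bm η : complexBetti (E₀.prod E₀).X 2,
      bp ∈ weilClassesPlus (E₀.prod E₀)
        (AbelianVariety.prodLift (AbelianVariety.fst E₀ E₀ ≫ ψ₀) (AbelianVariety.snd E₀ E₀ ≫ (-ψ₀))) 1 d ∧
      bm ∈ weilClassesMinus (E₀.prod E₀)
        (AbelianVariety.prodLift (AbelianVariety.fst E₀ E₀ ≫ ψ₀) (AbelianVariety.snd E₀ E₀ ≫ (-ψ₀))) 1 d ∧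
      IsRationalClass (bp + bm) ∧ IsOfHodgeType 2 (E₀.prod E₀).X 2 1 1 (bp + bm) ∧
      η ∈ algebraicClasses (E₀.prod E₀).X 1 ∧
      cupProduct (show 2 + 2 = 4 from rfl) bp η ≠ 0 ∧ cupProduct (show 2 + 2 = 4 from rfl) bm η ≠ 0 ∧
      bp ≠ 0 ∧ bm ≠ 0 := by
  classical
  -- notation
  set B := E₀.prod E₀ with hB
  set Φ : B ⟶ B := AbelianVariety.prodLift (AbelianVariety.fst E₀ E₀ ≫ ψ₀)
    (AbelianVariety.snd E₀ E₀ ≫ (-ψ₀)) with hΦ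
  have hX : IsSmoothProjective 1 E₀.X := isSmoothProjective_of_dim_eq' hE
  have hB2 : IsSmoothProjective 2 B.X := isSmoothProjective_of_dim_eq' (dim_cmSquare hE)
  set T := (complexBetti.map ψ₀.hom.hom.hom 1).hom with hTdef
  have hT2 : ∀ c, T (T c) = -((d : ℂ) • c) := fun c ↦ complexBetti_map_map_one_of_comp_self hψ c
  set s : ℂ := Complex.I * (Real.sqrt d : ℂ) with hs
  have hs2 : s * s = -(d : ℂ) := by rw [← sq, hs, I_mul_sqrt_sq]
  have hs0 : s ≠ 0 := I_mul_sqrt_ne_zero hd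
  -- the rational basis `v, Tv` and the eigenvectors `w± = Tv ± s v`
  obtain ⟨v, hv, hv0⟩ := exists_isRationalClass_ne_zero_one hE
  have hTv : IsRationalClass (T v) := hv.map _
  have hli : LinearIndependent ℂ ![v, T v] := linearIndependent_pair_map_one hd hψ hv hv0
  set wp : complexBetti E₀.X 1 := T v + s • v with hwp
  set wm : complexBetti E₀.X 1 := T v - s • v with hwm
  have hTwp : T wp = s • wp := by
    rw [hwp, map_add, map_smul, hT2, smul_add, smul_smul, hs2, neg_smul, add_comm]
  have hTwm : T wm = (-s) • wm := by
    rw [hwm, map_sub, map_smul, hT2, smul_sub, smul_smul, neg_mul, hs2, neg_neg, neg_smul]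
    abel
  have hwp0 : wp ≠ 0 := by
    intro h
    have h' : s • v + (1 : ℂ) • T v = 0 := by rw [one_smul, add_comm]; exact h
    exact hs0 (LinearIndependent.pair_iff.1 hli s 1 h').1
  -- conjugation: `conj wp = wm`
  have hconj : conjClass (ComplexPoints E₀.X) 1 wp = wm := by
    rw [hwp, hwm, conjClass_add, conjClass_smul, hTv.conjClass_eq, hv.conjClass_eq, hs]
    simp only [map_mul, Complex.conj_I, Complex.conj_ofReal]
    rw [neg_mul, neg_smul, sub_eq_add_neg]
  -- the `+s`-eigenspace of `T` is a line, spanned by `wp`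
  have hline : ∀ c' : complexBetti E₀.X 1, complexBetti.map ψ₀.hom.hom.hom 1 c' = s • c' →
      ∃ t : ℂ, c' = t • wp := by
    intro c' hc'
    haveI : Module.Finite ℂ (complexBetti E₀.X 1) := finite_complexBetti_abelianVariety E₀ 1
    have hdim : Module.finrank ℂ (Module.End.eigenspace T s) = 1 := by
      have h := two_mul_finrank_eigenspace_eq hd hψ
      rw [finrank_complexBetti_one_of_dim_eq_one hE] at h
      change 2 * Module.finrank ℂ (Module.End.eigenspace T s) = 2 at h
      omega
    have hwpmem : wp ∈ Module.End.eigenspace T s := Module.End.mem_eigenspace_iff.2 hTwp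
    have hc'mem : c' ∈ Module.End.eigenspace T s := Module.End.mem_eigenspace_iff.2 hc'
    have hne : (⟨wp, hwpmem⟩ : Module.End.eigenspace T s) ≠ 0 := fun h ↦
      hwp0 (congrArg Subtype.val h)
    obtain ⟨t, ht⟩ := (finrank_eq_one_iff_of_nonzero' _ hne).1 hdim ⟨c', hc'mem⟩
    exact ⟨t, (congrArg Subtype.val ht).symm⟩
  -- purity of `wp`, and the conjugate type for `wm`
  have hpure : IsOfHodgeType 1 E₀.X 1 1 0 wp ∨ IsOfHodgeType 1 E₀.X 1 0 1 wp :=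
    isOfHodgeType_one_or_of_eigenvector hX ψ₀.hom.hom.hom s hTwp hline
  obtain ⟨p, q, hpq, hwpt, hwmt⟩ : ∃ p q : ℕ, p + q = 1 ∧ IsOfHodgeType 1 E₀.X 1 p q wp ∧
      IsOfHodgeType 1 E₀.X 1 q p wm := by
    rcases hpure with h | h
    · exact ⟨1, 0, rfl, h, hconj ▸ h.conjClass hX⟩
    · exact ⟨0, 1, rfl, h, hconj ▸ h.conjClass hX⟩
  -- the classes on `B`
  set Xf := (complexBetti.map (AbelianVariety.fst E₀ E₀).hom.hom.hom 1).hom with hXf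
  set Yf := (complexBetti.map (AbelianVariety.snd E₀ E₀).hom.hom.hom 1).hom with hYf
  set P := cupProduct (X := ComplexPoints B.X) (R := ℂ) (show 1 + 1 = 2 from rfl) with hP
  set bp : complexBetti B.X 2 := P (Xf wp) (Yf wm) with hbp
  set bm : complexBetti B.X 2 := P (Xf wm) (Yf wp) with hbm
  -- (1) the Weil typing
  have hp₁ : AbelianVariety.fst E₀ E₀ ≫ ψ₀ = Φ ≫ AbelianVariety.fst E₀ E₀ :=
    (AbelianVariety.prodLift_fst _ _).symm
  have hp₂ : AbelianVariety.snd E₀ E₀ ≫ (-ψ₀) = Φ ≫ AbelianVariety.snd E₀ E₀ :=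
    (AbelianVariety.prodLift_snd _ _).symm
  have hnegT : ∀ c, complexBetti.map (-ψ₀).hom.hom.hom 1 c = -(T c) := fun c ↦ by
    rw [complexBetti_map_neg_one]; rfl
  have hwp_plus : wp ∈ pullbackEigenclasses E₀ ψ₀ 1
      (fun x y ↦ (x : ℂ) + (y : ℂ) * Complex.I * (Real.sqrt d : ℂ)) := by
    rw [pullbackEigenclasses_one_eq_eigenspace]
    exact Module.End.mem_eigenspace_iff.2 hTwp
  have hwm_minus : wm ∈ pullbackEigenclasses E₀ ψ₀ 1
      (fun x y ↦ (x : ℂ) - (y : ℂ) * Complex.I * (Real.sqrt d : ℂ)) := by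
    rw [pullbackEigenclasses_one_eq_eigenspace_neg]
    exact Module.End.mem_eigenspace_iff.2 hTwm
  have hwm_plus' : wm ∈ pullbackEigenclasses E₀ (-ψ₀) 1
      (fun x y ↦ (x : ℂ) + (y : ℂ) * Complex.I * (Real.sqrt d : ℂ)) := by
    rw [pullbackEigenclasses_one_eq_eigenspace, Module.End.mem_eigenspace_iff]
    change complexBetti.map (-ψ₀).hom.hom.hom 1 wm = s • wm
    rw [hnegT, hTwm, neg_smul, neg_neg]
  have hwp_minus' : wp ∈ pullbackEigenclasses E₀ (-ψ₀) 1
      (fun x y ↦ (x : ℂ) - (y : ℂ) * Complex.I * (Real.sqrt d : ℂ)) := by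
    rw [pullbackEigenclasses_one_eq_eigenspace_neg, Module.End.mem_eigenspace_iff]
    change complexBetti.map (-ψ₀).hom.hom.hom 1 wp = (-s) • wp
    rw [hnegT, hTwp, neg_smul]
  have hbp_mem : bp ∈ weilClassesPlus B Φ 1 d := by
    have h := cupProduct_map_map_mem_pullbackEigenclasses hp₁ hp₂ (rfl : 1 + 1 = 2) hwp_plus hwm_plus'
    rw [mem_weilClassesPlus_iff]
    intro x y
    have h' := (mem_pullbackEigenclasses_iff.1 h) x y
    rw [h']
    congr 1
    ring
  have hbm_mem : bm ∈ weilClassesMinus B Φ 1 d := by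
    have h := cupProduct_map_map_mem_pullbackEigenclasses hp₁ hp₂ (rfl : 1 + 1 = 2) hwm_minus hwp_minus'
    rw [mem_weilClassesMinus_iff]
    intro x y
    have h' := (mem_pullbackEigenclasses_iff.1 h) x y
    rw [h']
    congr 1
    ring
  -- (2) `bp + bm = 2·(XTv ∪ YTv) + 2d·(Xv ∪ Yv)` is rational
  have hsum : bp + bm = ((2 : ℚ) : ℂ) • P (Xf (T v)) (Yf (T v)) + ((2 * d : ℚ) : ℂ) • P (Xf v) (Yf v) := by
    rw [hbp, hbm, hwp, hwm]
    simp only [map_add, map_sub, map_smul, LinearMap.add_apply, LinearMap.sub_apply,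
      LinearMap.smul_apply, smul_sub, smul_add, smul_smul, hs2]
    push_cast
    module
  have hrat : IsRationalClass (bp + bm) := by
    rw [hsum]
    exact ((isRationalClass_cupProduct_map_fst_map_snd (rfl : 1 + 1 = 2) hTv hTv).smul 2).add
      ((isRationalClass_cupProduct_map_fst_map_snd (rfl : 1 + 1 = 2) hv hv).smul (2 * d))
  -- (3) Hodge type `(1,1)`
  have hdR : ∀ (E : Type) [NormedAddCommGroup E] [NormedSpace ℂ E] [FiniteDimensional ℂ E],
      Literature.NumberTheory.Transcendental.exists_deRhamIsoFamily (modelWithCornersSelf ℝ E) :=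
    fun E _ _ _ ↦ Literature.NumberTheory.Transcendental.exists_deRhamIsoFamily_holds E
  have hbp_t : IsOfHodgeType 2 B.X 2 1 1 bp := by
    have h := isOfHodgeType_cupProduct_map_fst_map_snd_of_multiplicative_deRham hdR E₀ E₀ 1 1 hE hE
      1 1 2 rfl p q q p wp wm hwpt hwmt
    have e1 : p + q = 1 := hpq
    have e2 : q + p = 1 := by omega
    rw [e1, e2] at h
    exact h
  have hbm_t : IsOfHodgeType 2 B.X 2 1 1 bm := by
    have h := isOfHodgeType_cupProduct_map_fst_map_snd_of_multiplicative_deRham hdR E₀ E₀ 1 1 hE hE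
      1 1 2 rfl q p p q wm wp hwmt hwpt
    have e1 : q + p = 1 := by omega
    have e2 : p + q = 1 := hpq
    rw [e1, e2] at h
    exact h
  have htype : IsOfHodgeType 2 B.X 2 1 1 (bp + bm) := hbp_t.add hB2 hbm_t
  -- (4) the algebraic class `η = (pr₁ + pr₂)^*(v ∪ Tv)`
  set ω₀ : complexBetti E₀.X 2 := cupProduct (show 1 + 1 = 2 from rfl) v (T v) with hω₀
  have hω₀0 : ω₀ ≠ 0 := cupProduct_map_one_ne_zero hE hd hψ hv hv0
  have hω₀alg : ω₀ ∈ algebraicClasses E₀.X 1 := mem_algebraicClasses_of_degree_top hX le_rfl ω₀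
  set η : complexBetti B.X 2 :=
    complexBetti.map (AbelianVariety.fst E₀ E₀ + AbelianVariety.snd E₀ E₀).hom.hom.hom 2 ω₀ with hη
  have hηalg : η ∈ algebraicClasses B.X 1 := map_fst_add_snd_mem_algebraicClasses E₀ (p := 1) hω₀alg
  -- `η = (Xv + Yv) ∪ (XTv + YTv)`
  have hηsum : η = P (Xf v + Yf v) (Xf (T v) + Yf (T v)) := by
    rw [hη, hω₀, hXf, hYf, hP]
    change complexBetti.map _ 2 (cupProduct _ v (T v)) = _
    rw [cupProduct_map, complexBetti_map_add_deg_one, complexBetti_map_add_deg_one]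
  -- (5) the two cup products: `b± ⌣ η = ∓2s · Xω₀ ∪ Yω₀ ≠ 0`
  have hFS : cupProduct (show 2 + 2 = 4 from rfl)
      (complexBetti.map (AbelianVariety.fst E₀ E₀).hom.hom.hom 2 ω₀)
      (complexBetti.map (AbelianVariety.snd E₀ E₀).hom.hom.hom 2 ω₀) ≠ 0 :=
    cupProduct_map_fst_map_snd_ne_zero (Y := E₀.X) (Z := E₀.X) hX hX (k := 4) (q := 2) (by norm_num)
      (by norm_num) hω₀0 hω₀0
  have h2s : (-(2 * s)) ≠ 0 := neg_ne_zero.2 (mul_ne_zero two_ne_zero hs0)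
  have h2s' : (-(2 * -s)) ≠ 0 := neg_ne_zero.2 (mul_ne_zero two_ne_zero (neg_ne_zero.2 hs0))
  have hbpη : cupProduct (show 2 + 2 = 4 from rfl) bp η ≠ 0 := by
    rw [hηsum, hbp, hwp, hwm]
    change cupProduct (show 2 + 2 = 4 from rfl)
      (cupProduct (show 1 + 1 = 2 from rfl)
        (complexBetti.map (AbelianVariety.fst E₀ E₀).hom.hom.hom 1 (T v + s • v))
        (complexBetti.map (AbelianVariety.snd E₀ E₀).hom.hom.hom 1 (T v - s • v)))
      (cupProduct (show 1 + 1 = 2 from rfl)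
        (complexBetti.map (AbelianVariety.fst E₀ E₀).hom.hom.hom 1 v +
          complexBetti.map (AbelianVariety.snd E₀ E₀).hom.hom.hom 1 v)
        (complexBetti.map (AbelianVariety.fst E₀ E₀).hom.hom.hom 1 (T v) +
          complexBetti.map (AbelianVariety.snd E₀ E₀).hom.hom.hom 1 (T v))) ≠ 0
    rw [cupProduct_weilComponent_sumClass hE s v (T v)]
    exact smul_ne_zero h2s hFS
  have hbmη : cupProduct (show 2 + 2 = 4 from rfl) bm η ≠ 0 := by
    rw [hηsum, hbm, hwp, hwm]
    have ewm : T v - s • v = T v + (-s) • v := by rw [neg_smul, sub_eq_add_neg]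
    have ewp : T v + s • v = T v - (-s) • v := by rw [neg_smul, sub_neg_eq_add]
    change cupProduct (show 2 + 2 = 4 from rfl)
      (cupProduct (show 1 + 1 = 2 from rfl)
        (complexBetti.map (AbelianVariety.fst E₀ E₀).hom.hom.hom 1 (T v - s • v))
        (complexBetti.map (AbelianVariety.snd E₀ E₀).hom.hom.hom 1 (T v + s • v)))
      (cupProduct (show 1 + 1 = 2 from rfl)
        (complexBetti.map (AbelianVariety.fst E₀ E₀).hom.hom.hom 1 v +
          complexBetti.map (AbelianVariety.snd E₀ E₀).hom.hom.hom 1 v)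
        (complexBetti.map (AbelianVariety.fst E₀ E₀).hom.hom.hom 1 (T v) +
          complexBetti.map (AbelianVariety.snd E₀ E₀).hom.hom.hom 1 (T v))) ≠ 0
    rw [ewm, ewp, cupProduct_weilComponent_sumClass hE (-s) v (T v)]
    exact smul_ne_zero h2s' hFS
  have hbp0 : bp ≠ 0 := fun h0 ↦ hbpη (by rw [h0, LinearMap.map_zero₂])
  have hbm0 : bm ≠ 0 := fun h0 ↦ hbmη (by rw [h0, LinearMap.map_zero₂])
  exact ⟨bp, bm, η, hbp_mem, hbm_mem, hrat, htype, hηalg, hbpη, hbmη, hbp0, hbm0⟩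

/-- **The surface conjunct of the aiming lemma, on the CM square.** For `E₀` of dimension `1` with
`ψ₀ ≫ ψ₀ = -(d • 𝟙)`, `d ≥ 1`: `B = E₀ × E₀` has dimension `2`, `Φ = ψ₀ × (-ψ₀)` satisfies
`Φ ≫ Φ = -((d : ℤ) • 𝟙 B)`, and `B` carries a descent pair in the typing of
`exists_cmWeilSurface_aimedSplitProduct_of_ne_one_of_ne_three`: `b₊ ∈ Eig((𝟙+Φ)^*, (1+i√d)²)`,
`b₋ ∈ Eig((𝟙+Φ)^*, (1-i√d)²)` (the Weil lines `E±(B)` are eigenspaces of the single test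
endomorphism `(𝟙 + Φ)^* = (1·𝟙 + 1·Φ)^*`), `b₊ + b₋` rational of Hodge type `(1,1)`,
`η ∈ N¹H²(B(ℂ); ℂ)` algebraic with `b₊ ⌣ η ≠ 0`, `b₋ ⌣ η ≠ 0` (`exists_descentPair_cmSquare`).
[cite: Schoen1998HodgeWeilAddendum, §10 (proof of the Proposition, p. 333)]
[cite: vanGeemen1994HodgeAV, 5.3] [cite: Markman2025SurveySecant, §11.5 Step 2] -/
theorem exists_cmSquare_surfaceConjunct (hE : E₀.dim = 1) (hd : 0 < d) (hψ : ψ₀ ≫ ψ₀ = -(d • 𝟙 E₀)) :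
    (E₀.prod E₀).dim = 2 ∧
    AbelianVariety.prodLift (AbelianVariety.fst E₀ E₀ ≫ ψ₀) (AbelianVariety.snd E₀ E₀ ≫ (-ψ₀)) ≫
        AbelianVariety.prodLift (AbelianVariety.fst E₀ E₀ ≫ ψ₀) (AbelianVariety.snd E₀ E₀ ≫ (-ψ₀)) =
      -((d : ℤ) • 𝟙 (E₀.prod E₀)) ∧
    ∃ bp bm η : complexBetti (E₀.prod E₀).X 2,
      bp ∈ Module.End.eigenspace (complexBetti.map (𝟙 (E₀.prod E₀) +
            AbelianVariety.prodLift (AbelianVariety.fst E₀ E₀ ≫ ψ₀)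
              (AbelianVariety.snd E₀ E₀ ≫ (-ψ₀))).hom.hom.hom 2).hom
            ((1 + Complex.I * (Real.sqrt (d : ℝ) : ℂ)) ^ 2) ∧
      bm ∈ Module.End.eigenspace (complexBetti.map (𝟙 (E₀.prod E₀) +
            AbelianVariety.prodLift (AbelianVariety.fst E₀ E₀ ≫ ψ₀)
              (AbelianVariety.snd E₀ E₀ ≫ (-ψ₀))).hom.hom.hom 2).hom
            ((1 - Complex.I * (Real.sqrt (d : ℝ) : ℂ)) ^ 2) ∧
      IsRationalClass (bp + bm) ∧ IsOfHodgeType 2 (E₀.prod E₀).X 2 1 1 (bp + bm) ∧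
      η ∈ algebraicClasses (E₀.prod E₀).X 1 ∧
      cupProduct (show 2 + 2 = 4 from rfl) bp η ≠ 0 ∧
      cupProduct (show 2 + 2 = 4 from rfl) bm η ≠ 0 := by
  refine ⟨by rw [dim_cmSquare hE], by rw [natCast_zsmul]; exact cmSquare_comp_self hψ, ?_⟩
  obtain ⟨bp, bm, η, hbp, hbm, hrat, htype, hη, hbpη, hbmη, -, -⟩ := exists_descentPair_cmSquare hE hd hψ
  have hone : ((1 : ℕ) • 𝟙 (E₀.prod E₀) +
      (1 : ℕ) • AbelianVariety.prodLift (AbelianVariety.fst E₀ E₀ ≫ ψ₀) (AbelianVariety.snd E₀ E₀ ≫ (-ψ₀)) :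
        E₀.prod E₀ ⟶ E₀.prod E₀) =
      𝟙 (E₀.prod E₀) +
        AbelianVariety.prodLift (AbelianVariety.fst E₀ E₀ ≫ ψ₀) (AbelianVariety.snd E₀ E₀ ≫ (-ψ₀)) := by
    simp
  have hsqrt : (((1 : ℕ) : ℂ) + ((1 : ℕ) : ℂ) * Complex.I * (Real.sqrt d : ℂ)) ^ (2 * 1) =
      (1 + Complex.I * (Real.sqrt (d : ℝ) : ℂ)) ^ 2 := by push_cast; ring
  have hsqrt' : (((1 : ℕ) : ℂ) - ((1 : ℕ) : ℂ) * Complex.I * (Real.sqrt d : ℂ)) ^ (2 * 1) =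
      (1 - Complex.I * (Real.sqrt (d : ℝ) : ℂ)) ^ 2 := by push_cast; ring
  refine ⟨bp, bm, η, ?_, ?_, hrat, htype, hη, hbpη, hbmη⟩
  · rw [Module.End.mem_eigenspace_iff]
    have h := (mem_weilClassesPlus_iff.1 hbp) 1 1
    rw [hone, hsqrt] at h
    exact h
  · rw [Module.End.mem_eigenspace_iff]
    have h := (mem_weilClassesMinus_iff.1 hbm) 1 1
    rw [hone, hsqrt'] at h
    exact h

end CMSquare

end Literature.AlgebraicGeometry.Motives

end
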